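import Summits.AtomisticToContinuum.Crystallization.Theorems.PricedLinkCensusTruncatedCensusGapFarLocality
import Summits.AtomisticToContinuum.Crystallization.Theorems.PricedLinkCensusTruncatedCensusGapCruxForms

/-!
# The Barlow far-site gap (FAR) implies a periodic far-site pricing

Helper (FAR-PERIODIC FORM, part 1 of 2: blocks) for the stub `stub_barlowFarSiteGap` (FAR, the
open core) of the line `near-far-split` (`Cruxes/TruncatedCensusGap/Lines/near_far_split.lean`)
of the crux `PricedLinkCensus.TruncatedCensusGap` (item stmt-AtomisticToContinuum-14230); the
FAR-twin of `periodicUnderPricing_of_underCoordinationGap`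
(`…UnderCoordinationPeriodicBlocks.lean`, class (U) of line `birth`) and of
`periodicPricing_of_truncatedCensusGap` (`…CruxForms.lean`).  Write
`V_χ r = min 1 (max 0 (4 - 2r)) · V_LJ r` for the range-2 truncated Lennard-Jones potential,
`e_χ* = ⨅_Q e_χ(Q)` for the infimum of its energy per particle over periodic configurations of
`ℝ³`, and call a site `i` of a configuration `y : ι → ℝ³` NEAR-BARLOW when its `a/2`-separated
closed `3a`-patch is two-way `a/50`-matched to a moved Barlow stacking `g '' barlowStacking a c s`
(`a ∈ [93/100, 51/50]`, `c ∈ [78a/100, 86a/100]`, `s` a Hägg word, `g` a rigid motion) — the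
predicate `∃ a c s g, …` inlined in the stub and spelled out in every statement below (see
`…FarLocality.lean`); FAR = not near-Barlow, `Far(y) = {i | ¬ ∃ a c s g, …}`.  The stub (FAR)
reads `∃ κ > 0, ∀ N (y : Fin N → ℝ³) injective, N · e_χ* + κ · #Far(y) ≤ E_χ(y)`.

**Theorem (`periodicFarPricing_of_farSiteGap`).**  (FAR) implies, with the same `κ`, the
PERIODIC FAR-SITE PRICING
`∀ Q : PeriodicConfiguration 3, κ · #{motif sites of Q that are far in Q.points} ≤ #F · (e_χ(Q) − e_χ*)`
(far being read in the infinite point set `Q.points`, configuration `Subtype.val`): the blocks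
`blockConfig Q K` are `V_χ`-trial states (`exists_block_energy_le_truncLJ`); by FAR-LOCALITY
(`nearBarlow_apply_iff_comp`, radius `357/100 < 4`) and `Blocks.exists_eq_toP_of_dist_lt`,
`(depth Q 4)`-deep block points are far in the block iff they are far in `Q`
(`farBarlow_block_iff`), and by translation invariance (`nearBarlow_transl_iff`) iff their
motif point is far in `Q`; so the block has at least `#deep · #Far-motif(Q)` far sites
(`card_far_block_ge`), non-deep lattice coordinates being `≤ 6 · depth · K²`
(`Blocks.card_deep_ge`).  The converse and the equivalence are part 2
(`…FarPeriodicForm.lean`).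

All `[folklore]` bookkeeping; the content of (FAR) is untouched.
-/

noncomputable section

namespace Summit.AtomisticToContinuum.Crystallization.Theorems.PricedLinkCensusTruncatedCensusGap

open Literature.MathematicalPhysics.StatisticalMechanics Literature.Geometry.DiscreteGeometry
open Summit.AtomisticToContinuum.Crystallization.Theorems.ChargedEnergyGapNegative
open Summit.AtomisticToContinuum.Crystallization.Theorems.ChargedEnergyGapNegative.Blocks

/-! ## Far sites under re-indexing -/

/-- Re-indexing the sites by an equivalence preserves the number of far sites. [folklore] -/
theorem card_far_comp_equiv {ι κ : Type*} (y : ι → EuclideanSpace ℝ (Fin 3)) (e : κ ≃ ι) :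
    Nat.card {i : κ // ¬ ∃ (a c : ℝ) (s : ℤ → ℤ) (g : EuclideanSpace ℝ (Fin 3) ≃ᵃⁱ[ℝ] EuclideanSpace ℝ (Fin 3)), 93 / 100 ≤ a ∧ a ≤ 51 / 50 ∧ 78 / 100 * a ≤ c ∧ c ≤ 86 / 100 * a ∧ Literature.MathematicalPhysics.StatisticalMechanics.IsHaggSeq s ∧ (∀ j k, j ≠ k → dist ((y ∘ ⇑e) j) ((y ∘ ⇑e) i) ≤ 3 * a → a / 2 ≤ dist ((y ∘ ⇑e) j) ((y ∘ ⇑e) k)) ∧ (∀ j, dist ((y ∘ ⇑e) j) ((y ∘ ⇑e) i) ≤ 3 * a → ∃ z ∈ Literature.MathematicalPhysics.StatisticalMechanics.barlowStacking a c s, dist ((y ∘ ⇑e) j) (g z) ≤ a / 50) ∧ (∀ z ∈ Literature.MathematicalPhysics.StatisticalMechanics.barlowStacking a c s, dist (g z) ((y ∘ ⇑e) i) ≤ 3 * a → ∃ j, dist ((y ∘ ⇑e) j) (g z) ≤ a / 50)} =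
      Nat.card {i : ι // ¬ ∃ (a c : ℝ) (s : ℤ → ℤ) (g : EuclideanSpace ℝ (Fin 3) ≃ᵃⁱ[ℝ] EuclideanSpace ℝ (Fin 3)), 93 / 100 ≤ a ∧ a ≤ 51 / 50 ∧ 78 / 100 * a ≤ c ∧ c ≤ 86 / 100 * a ∧ Literature.MathematicalPhysics.StatisticalMechanics.IsHaggSeq s ∧ (∀ j k, j ≠ k → dist (y j) (y i) ≤ 3 * a → a / 2 ≤ dist (y j) (y k)) ∧ (∀ j, dist (y j) (y i) ≤ 3 * a → ∃ z ∈ Literature.MathematicalPhysics.StatisticalMechanics.barlowStacking a c s, dist (y j) (g z) ≤ a / 50) ∧ (∀ z ∈ Literature.MathematicalPhysics.StatisticalMechanics.barlowStacking a c s, dist (g z) (y i) ≤ 3 * a → ∃ j, dist (y j) (g z) ≤ a / 50)} :=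
  Nat.card_congr (e.subtypeEquiv fun i => not_congr (nearBarlow_comp_equiv_iff y e i))

/-! ## Blocks: deep block points over far motif points are far -/

section BlockCount

variable (Q : PeriodicConfiguration 3) (K : ℕ)

/-- **Translation invariance of the near-Barlow predicate in `Q`.** [folklore] -/
theorem nearBarlow_transl_iff {t : E3} (ht : t ∈ Q.lattice) (p : Q.points) :
    (∃ (a c : ℝ) (s : ℤ → ℤ) (g : EuclideanSpace ℝ (Fin 3) ≃ᵃⁱ[ℝ] EuclideanSpace ℝ (Fin 3)), 93 / 100 ≤ a ∧ a ≤ 51 / 50 ∧ 78 / 100 * a ≤ c ∧ c ≤ 86 / 100 * a ∧ Literature.MathematicalPhysics.StatisticalMechanics.IsHaggSeq s ∧ (∀ j k, j ≠ k → dist ((ptConfig Q) j) ((ptConfig Q) (transl Q ht p)) ≤ 3 * a → a / 2 ≤ dist ((ptConfig Q) j) ((ptConfig Q) k)) ∧ (∀ j, dist ((ptConfig Q) j) ((ptConfig Q) (transl Q ht p)) ≤ 3 * a → ∃ z ∈ Literature.MathematicalPhysics.StatisticalMechanics.barlowStacking a c s, dist ((ptConfig Q) j) (g z) ≤ a / 50)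 ∧ (∀ z ∈ Literature.MathematicalPhysics.StatisticalMechanics.barlowStacking a c s, dist (g z) ((ptConfig Q) (transl Q ht p)) ≤ 3 * a → ∃ j, dist ((ptConfig Q) j) (g z) ≤ a / 50)) ↔
      (∃ (a c : ℝ) (s : ℤ → ℤ) (g : EuclideanSpace ℝ (Fin 3) ≃ᵃⁱ[ℝ] EuclideanSpace ℝ (Fin 3)), 93 / 100 ≤ a ∧ a ≤ 51 / 50 ∧ 78 / 100 * a ≤ c ∧ c ≤ 86 / 100 * a ∧ Literature.MathematicalPhysics.StatisticalMechanics.IsHaggSeq s ∧ (∀ j k, j ≠ k → dist ((ptConfig Q) j) ((ptConfig Q) p) ≤ 3 * a → a / 2 ≤ dist ((ptConfig Q) j) ((ptConfig Q) k)) ∧ (∀ j, dist ((ptConfig Q) j) ((ptConfig Q) p) ≤ 3 * a → ∃ z ∈ Literature.MathematicalPhysics.StatisticalMechanics.barlowStacking a c s, dist ((ptConfig Q) j) (g z) ≤ a / 50) ∧ (∀ z ∈ Literature.MathematicalPhysics.StatisticalMechanics.barlowStacking a c s, dist (g z) ((ptConfig Q) p) ≤ 3 * a → ∃ j, dist ((ptConfig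 Q) j) (g z) ≤ a / 50)) := by
  rw [← nearBarlow_comp_equiv_iff (ptConfig Q) (transl Q ht) p, ptConfig_comp_transl,
    nearBarlow_add_const_comp_iff]

/-- The near-Barlow predicate in `Q` is the same at all block points over the same motif
point. [folklore] -/
theorem nearBarlow_toP_iff_motif (u : BIdx Q K) :
    (∃ (a c : ℝ) (s : ℤ → ℤ) (g : EuclideanSpace ℝ (Fin 3) ≃ᵃⁱ[ℝ] EuclideanSpace ℝ (Fin 3)), 93 / 100 ≤ a ∧ a ≤ 51 / 50 ∧ 78 / 100 * a ≤ c ∧ c ≤ 86 / 100 * a ∧ Literature.MathematicalPhysics.StatisticalMechanics.IsHaggSeq s ∧ (∀ j k, j ≠ k → dist ((ptConfig Q) j) ((ptConfig Q) (toP Q K u)) ≤ 3 * a → a / 2 ≤ dist ((ptConfig Q) j) ((ptConfig Q) k)) ∧ (∀ j, dist ((ptConfig Q) j) ((ptConfig Q) (toP Q K u)) ≤ 3 * a → ∃ z ∈ Literature.MathematicalPhysics.StatisticalMechanics.barlowStacking a c s, dist ((ptConfig Q) j) (g z) ≤ a / 50) ∧ (∀ z ∈ Literature.MathematicalPhysics.StatisticalMechanics.barlowStacking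 a c s, dist (g z) ((ptConfig Q) (toP Q K u)) ≤ 3 * a → ∃ j, dist ((ptConfig Q) j) (g z) ≤ a / 50)) ↔
      (∃ (a c : ℝ) (s : ℤ → ℤ) (g : EuclideanSpace ℝ (Fin 3) ≃ᵃⁱ[ℝ] EuclideanSpace ℝ (Fin 3)), 93 / 100 ≤ a ∧ a ≤ 51 / 50 ∧ 78 / 100 * a ≤ c ∧ c ≤ 86 / 100 * a ∧ Literature.MathematicalPhysics.StatisticalMechanics.IsHaggSeq s ∧ (∀ j k, j ≠ k → dist ((ptConfig Q) j) ((ptConfig Q) ⟨u.1.1, Q.mem_points_of_mem_motif u.1.2⟩) ≤ 3 * a → a / 2 ≤ dist ((ptConfig Q) j) ((ptConfig Q) k)) ∧ (∀ j, dist ((ptConfig Q) j) ((ptConfig Q) ⟨u.1.1, Q.mem_points_of_mem_motif u.1.2⟩) ≤ 3 * a → ∃ z ∈ Literature.MathematicalPhysics.StatisticalMechanics.barlowStacking a c s, dist ((ptConfig Q) j) (g z) ≤ a / 50) ∧ (∀ z ∈ Literature.MathematicalPhysics.StatisticalMechanics.barlowStacking a c s, dist (g z) ((ptConfig Q) ⟨u.1.1,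 Q.mem_points_of_mem_motif u.1.2⟩) ≤ 3 * a → ∃ j, dist ((ptConfig Q) j) (g z) ≤ a / 50)) := by
  have h : toP Q K u = transl Q (latVec_mem Q (coords K u.2))
      ⟨u.1.1, Q.mem_points_of_mem_motif u.1.2⟩ := Subtype.ext rfl
  rw [h, nearBarlow_transl_iff]

/-- Points of `Q` within `357/100` of a `(depth 4)`-deep block point are block points. [folklore] -/
theorem mem_range_toP_of_deep {u : BIdx Q K} (hu : IsDeep K (depth Q 4) u.2) (q : Q.points)
    (hq : dist (ptConfig Q q) (ptConfig Q (toP Q K u)) ≤ 357 / 100) :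
    q ∈ Set.range (toP Q K) := by
  by_cases hne : q = toP Q K u
  · exact ⟨u, hne.symm⟩
  · have hlt : dist (bpt Q K u) q.1 < 4 := by
      have : dist (bpt Q K u) q.1 = dist (ptConfig Q q) (ptConfig Q (toP Q K u)) := dist_comm _ _
      linarith
    obtain ⟨v, -, hv⟩ := exists_eq_toP_of_dist_lt Q K hu q hne hlt
    exact ⟨v, hv⟩

/-- **The near-Barlow predicate of `(depth 4)`-deep block points is that of `Q`** (far-site
locality at radius `357/100 < 4`). [folklore] -/
theorem nearBarlow_block_iff {u : BIdx Q K} (hu : IsDeep K (depth Q 4) u.2) :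
    (∃ (a c : ℝ) (s : ℤ → ℤ) (g : EuclideanSpace ℝ (Fin 3) ≃ᵃⁱ[ℝ] EuclideanSpace ℝ (Fin 3)), 93 / 100 ≤ a ∧ a ≤ 51 / 50 ∧ 78 / 100 * a ≤ c ∧ c ≤ 86 / 100 * a ∧ Literature.MathematicalPhysics.StatisticalMechanics.IsHaggSeq s ∧ (∀ j k, j ≠ k → dist ((bpt Q K) j) ((bpt Q K) u) ≤ 3 * a → a / 2 ≤ dist ((bpt Q K) j) ((bpt Q K) k)) ∧ (∀ j, dist ((bpt Q K) j) ((bpt Q K) u) ≤ 3 * a → ∃ z ∈ Literature.MathematicalPhysics.StatisticalMechanics.barlowStacking a c s, dist ((bpt Q K) j) (g z) ≤ a / 50) ∧ (∀ z ∈ Literature.MathematicalPhysics.StatisticalMechanics.barlowStacking a c s, dist (g z) ((bpt Q K) u) ≤ 3 * a → ∃ j, dist ((bpt Q K) j) (g z) ≤ a / 50)) ↔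
      (∃ (a c : ℝ) (s : ℤ → ℤ) (g : EuclideanSpace ℝ (Fin 3) ≃ᵃⁱ[ℝ] EuclideanSpace ℝ (Fin 3)), 93 / 100 ≤ a ∧ a ≤ 51 / 50 ∧ 78 / 100 * a ≤ c ∧ c ≤ 86 / 100 * a ∧ Literature.MathematicalPhysics.StatisticalMechanics.IsHaggSeq s ∧ (∀ j k, j ≠ k → dist ((ptConfig Q) j) ((ptConfig Q) (toP Q K u)) ≤ 3 * a → a / 2 ≤ dist ((ptConfig Q) j) ((ptConfig Q) k)) ∧ (∀ j, dist ((ptConfig Q) j) ((ptConfig Q) (toP Q K u)) ≤ 3 * a → ∃ z ∈ Literature.MathematicalPhysics.StatisticalMechanics.barlowStacking a c s, dist ((ptConfig Q) j) (g z) ≤ a / 50) ∧ (∀ z ∈ Literature.MathematicalPhysics.StatisticalMechanics.barlowStacking a c s, dist (g z) ((ptConfig Q) (toP Q K u)) ≤ 3 * a → ∃ j, dist ((ptConfig Q) j) (g z) ≤ a / 50)) := by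
  have hcomp : ptConfig Q ∘ toP Q K = bpt Q K := funext fun _ => rfl
  have key := nearBarlow_apply_iff_comp (ptConfig Q) (toP_injective Q K) u
    (fun q hq => mem_range_toP_of_deep Q K hu q hq)
  rw [hcomp] at key
  exact key.symm

/-- Far version: a `(depth 4)`-deep block point is far in the block iff it is far in `Q`.
[folklore] -/
theorem farBarlow_block_iff {u : BIdx Q K} (hu : IsDeep K (depth Q 4) u.2) :
    (¬ ∃ (a c : ℝ) (s : ℤ → ℤ) (g : EuclideanSpace ℝ (Fin 3) ≃ᵃⁱ[ℝ] EuclideanSpace ℝ (Fin 3)), 93 / 100 ≤ a ∧ a ≤ 51 / 50 ∧ 78 / 100 * a ≤ c ∧ c ≤ 86 / 100 * a ∧ Literature.MathematicalPhysics.StatisticalMechanics.IsHaggSeq s ∧ (∀ j k, j ≠ k → dist ((bpt Q K) j) ((bpt Q K) u) ≤ 3 * a → a / 2 ≤ dist ((bpt Q K) j) ((bpt Q K) k)) ∧ (∀ j, dist ((bpt Q K) j) ((bpt Q K) u) ≤ 3 * a → ∃ z ∈ Literature.MathematicalPhysics.StatisticalMechanics.barlowStacking a c s, dist ((bpt Q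 K) j) (g z) ≤ a / 50) ∧ (∀ z ∈ Literature.MathematicalPhysics.StatisticalMechanics.barlowStacking a c s, dist (g z) ((bpt Q K) u) ≤ 3 * a → ∃ j, dist ((bpt Q K) j) (g z) ≤ a / 50)) ↔
      (¬ ∃ (a c : ℝ) (s : ℤ → ℤ) (g : EuclideanSpace ℝ (Fin 3) ≃ᵃⁱ[ℝ] EuclideanSpace ℝ (Fin 3)), 93 / 100 ≤ a ∧ a ≤ 51 / 50 ∧ 78 / 100 * a ≤ c ∧ c ≤ 86 / 100 * a ∧ Literature.MathematicalPhysics.StatisticalMechanics.IsHaggSeq s ∧ (∀ j k, j ≠ k → dist ((ptConfig Q) j) ((ptConfig Q) (toP Q K u)) ≤ 3 * a → a / 2 ≤ dist ((ptConfig Q) j) ((ptConfig Q) k)) ∧ (∀ j, dist ((ptConfig Q) j) ((ptConfig Q) (toP Q K u)) ≤ 3 * a → ∃ z ∈ Literature.MathematicalPhysics.StatisticalMechanics.barlowStacking a c s, dist ((ptConfig Q) j) (g z) ≤ a / 50) ∧ (∀ z ∈ Literature.MathematicalPhysics.StatisticalMechanics.barlowStacking a c s, dist (g z) ((ptConfig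 Q) (toP Q K u)) ≤ 3 * a → ∃ j, dist ((ptConfig Q) j) (g z) ≤ a / 50)) :=
  not_congr (nearBarlow_block_iff Q K hu)

/-- The number of block points (indexed by `BIdx`) that are far in the BLOCK is at least
`#((depth 4)-deep lattice coordinates) · #(far motif sites of Q)`. [folklore] -/
theorem card_far_block_ge :
    Nat.card {k : Fin 3 → Fin K // IsDeep K (depth Q 4) k} *
        Nat.card {x : Q.motif // ¬ ∃ (a c : ℝ) (s : ℤ → ℤ) (g : EuclideanSpace ℝ (Fin 3) ≃ᵃⁱ[ℝ] EuclideanSpace ℝ (Fin 3)), 93 / 100 ≤ a ∧ a ≤ 51 / 50 ∧ 78 / 100 * a ≤ c ∧ c ≤ 86 / 100 * a ∧ Literature.MathematicalPhysics.StatisticalMechanics.IsHaggSeq s ∧ (∀ j k : Q.points, j ≠ k → dist ((Subtype.val : Q.points → EuclideanSpace ℝ (Fin 3)) j) ((Subtype.val : Q.points → EuclideanSpace ℝ (Fin 3)) ⟨x.1, Q.mem_points_of_mem_motif x.2⟩) ≤ 3 * a → a / 2 ≤ dist ((Subtype.val : Q.points → EuclideanSpace ℝ (Fin 3)) j) ((Subtype.val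 : Q.points → EuclideanSpace ℝ (Fin 3)) k)) ∧ (∀ j : Q.points, dist ((Subtype.val : Q.points → EuclideanSpace ℝ (Fin 3)) j) ((Subtype.val : Q.points → EuclideanSpace ℝ (Fin 3)) ⟨x.1, Q.mem_points_of_mem_motif x.2⟩) ≤ 3 * a → ∃ z ∈ Literature.MathematicalPhysics.StatisticalMechanics.barlowStacking a c s, dist ((Subtype.val : Q.points → EuclideanSpace ℝ (Fin 3)) j) (g z) ≤ a / 50) ∧ (∀ z ∈ Literature.MathematicalPhysics.StatisticalMechanics.barlowStacking a c s, dist (g z) ((Subtype.val : Q.points → EuclideanSpace ℝ (Fin 3)) ⟨x.1, Q.mem_points_of_mem_motif x.2⟩) ≤ 3 * a → ∃ j : Q.points, dist ((Subtype.val : Q.points → EuclideanSpace ℝ (Fin 3)) j) (g z) ≤ a / 50)} ≤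
      Nat.card {u : BIdx Q K // ¬ ∃ (a c : ℝ) (s : ℤ → ℤ) (g : EuclideanSpace ℝ (Fin 3) ≃ᵃⁱ[ℝ] EuclideanSpace ℝ (Fin 3)), 93 / 100 ≤ a ∧ a ≤ 51 / 50 ∧ 78 / 100 * a ≤ c ∧ c ≤ 86 / 100 * a ∧ Literature.MathematicalPhysics.StatisticalMechanics.IsHaggSeq s ∧ (∀ j k, j ≠ k → dist ((bpt Q K) j) ((bpt Q K) u) ≤ 3 * a → a / 2 ≤ dist ((bpt Q K) j) ((bpt Q K) k)) ∧ (∀ j, dist ((bpt Q K) j) ((bpt Q K) u) ≤ 3 * a → ∃ z ∈ Literature.MathematicalPhysics.StatisticalMechanics.barlowStacking a c s, dist ((bpt Q K) j) (g z) ≤ a / 50) ∧ (∀ z ∈ Literature.MathematicalPhysics.StatisticalMechanics.barlowStacking a c s, dist (g z) ((bpt Q K) u) ≤ 3 * a → ∃ j, dist ((bpt Q K) j) (g z) ≤ a / 50)} := by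
  classical
  let f : {k : Fin 3 → Fin K // IsDeep K (depth Q 4) k} ×
      {x : Q.motif // ¬ ∃ (a c : ℝ) (s : ℤ → ℤ) (g : EuclideanSpace ℝ (Fin 3) ≃ᵃⁱ[ℝ] EuclideanSpace ℝ (Fin 3)), 93 / 100 ≤ a ∧ a ≤ 51 / 50 ∧ 78 / 100 * a ≤ c ∧ c ≤ 86 / 100 * a ∧ Literature.MathematicalPhysics.StatisticalMechanics.IsHaggSeq s ∧ (∀ j k : Q.points, j ≠ k → dist ((Subtype.val : Q.points → EuclideanSpace ℝ (Fin 3)) j) ((Subtype.val : Q.points → EuclideanSpace ℝ (Fin 3)) ⟨x.1, Q.mem_points_of_mem_motif x.2⟩) ≤ 3 * a → a / 2 ≤ dist ((Subtype.val : Q.points → EuclideanSpace ℝ (Fin 3)) j) ((Subtype.val : Q.points → EuclideanSpace ℝ (Fin 3)) k)) ∧ (∀ j : Q.points, dist ((Subtype.val : Q.points → EuclideanSpace ℝ (Fin 3)) j) ((Subtype.val : Q.points → EuclideanSpace ℝ (Fin 3)) ⟨x.1, Q.mem_points_of_mem_motif x.2⟩) ≤ 3 * a → ∃ z ∈ Literature.MathematicalPhysics.StatisticalMechanics.barlowStacking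 a c s, dist ((Subtype.val : Q.points → EuclideanSpace ℝ (Fin 3)) j) (g z) ≤ a / 50) ∧ (∀ z ∈ Literature.MathematicalPhysics.StatisticalMechanics.barlowStacking a c s, dist (g z) ((Subtype.val : Q.points → EuclideanSpace ℝ (Fin 3)) ⟨x.1, Q.mem_points_of_mem_motif x.2⟩) ≤ 3 * a → ∃ j : Q.points, dist ((Subtype.val : Q.points → EuclideanSpace ℝ (Fin 3)) j) (g z) ≤ a / 50)} →
      {u : BIdx Q K // ¬ ∃ (a c : ℝ) (s : ℤ → ℤ) (g : EuclideanSpace ℝ (Fin 3) ≃ᵃⁱ[ℝ] EuclideanSpace ℝ (Fin 3)), 93 / 100 ≤ a ∧ a ≤ 51 / 50 ∧ 78 / 100 * a ≤ c ∧ c ≤ 86 / 100 * a ∧ Literature.MathematicalPhysics.StatisticalMechanics.IsHaggSeq s ∧ (∀ j k, j ≠ k → dist ((bpt Q K) j) ((bpt Q K) u) ≤ 3 * a → a / 2 ≤ dist ((bpt Q K) j) ((bpt Q K) k)) ∧ (∀ j, dist ((bpt Q K) j) ((bpt Q K) u) ≤ 3 * a → ∃ z ∈ Literature.MathematicalPhysics.StatisticalMechanics.barlowStacking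 a c s, dist ((bpt Q K) j) (g z) ≤ a / 50) ∧ (∀ z ∈ Literature.MathematicalPhysics.StatisticalMechanics.barlowStacking a c s, dist (g z) ((bpt Q K) u) ≤ 3 * a → ∃ j, dist ((bpt Q K) j) (g z) ≤ a / 50)} :=
    fun p => ⟨(p.2.1, p.1.1), by
      rw [farBarlow_block_iff Q K (u := (p.2.1, p.1.1)) p.1.2, nearBarlow_toP_iff_motif]
      exact p.2.2⟩
  have hf : Function.Injective f := by
    rintro ⟨⟨k, hk⟩, ⟨x, hx⟩⟩ ⟨⟨k', hk'⟩, ⟨x', hx'⟩⟩ h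
    have h' := congrArg (fun w => w.1) h
    simp only [f] at h'
    obtain ⟨rfl, rfl⟩ := Prod.ext_iff.1 h'
    rfl
  have := Nat.card_le_card_of_injective f hf
  rw [Nat.card_prod] at this
  exact this

/-- The block configuration (indexed by `Fin (#F K³)`) has as many far sites as the block
indexed by `BIdx`. [folklore] -/
theorem far_blockConfig_eq :
    Nat.card {i : Fin (Fintype.card (BIdx Q K)) // ¬ ∃ (a c : ℝ) (s : ℤ → ℤ) (g : EuclideanSpace ℝ (Fin 3) ≃ᵃⁱ[ℝ] EuclideanSpace ℝ (Fin 3)), 93 / 100 ≤ a ∧ a ≤ 51 / 50 ∧ 78 / 100 * a ≤ c ∧ c ≤ 86 / 100 * a ∧ Literature.MathematicalPhysics.StatisticalMechanics.IsHaggSeq s ∧ (∀ j k, j ≠ k → dist ((blockConfig Q K) j) ((blockConfig Q K) i) ≤ 3 * a → a / 2 ≤ dist ((blockConfig Q K) j) ((blockConfig Q K) k)) ∧ (∀ j, dist ((blockConfig Q K) j) ((blockConfig Q K) i) ≤ 3 * a → ∃ z ∈ Literature.MathematicalPhysics.StatisticalMechanics.barlowStacking a c s, dist ((blockConfig Q K)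 j) (g z) ≤ a / 50) ∧ (∀ z ∈ Literature.MathematicalPhysics.StatisticalMechanics.barlowStacking a c s, dist (g z) ((blockConfig Q K) i) ≤ 3 * a → ∃ j, dist ((blockConfig Q K) j) (g z) ≤ a / 50)} =
      Nat.card {u : BIdx Q K // ¬ ∃ (a c : ℝ) (s : ℤ → ℤ) (g : EuclideanSpace ℝ (Fin 3) ≃ᵃⁱ[ℝ] EuclideanSpace ℝ (Fin 3)), 93 / 100 ≤ a ∧ a ≤ 51 / 50 ∧ 78 / 100 * a ≤ c ∧ c ≤ 86 / 100 * a ∧ Literature.MathematicalPhysics.StatisticalMechanics.IsHaggSeq s ∧ (∀ j k, j ≠ k → dist ((bpt Q K) j) ((bpt Q K) u) ≤ 3 * a → a / 2 ≤ dist ((bpt Q K) j) ((bpt Q K) k)) ∧ (∀ j, dist ((bpt Q K) j) ((bpt Q K) u) ≤ 3 * a → ∃ z ∈ Literature.MathematicalPhysics.StatisticalMechanics.barlowStacking a c s, dist ((bpt Q K) j) (g z) ≤ a / 50) ∧ (∀ z ∈ Literature.MathematicalPhysics.StatisticalMechanics.barlowStacking a c s, dist (g z) ((bpt Q K) u) ≤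 3 * a → ∃ j, dist ((bpt Q K) j) (g z) ≤ a / 50)} := by
  rw [blockConfig]
  exact card_far_comp_equiv (bpt Q K) (Fintype.equivFin (BIdx Q K)).symm

end BlockCount

/-! ## The block arithmetic (potential-free) -/

/-- **Pricing from block estimates** (the arithmetic of the block argument, isolated).  Suppose
that for every slack `ε > 0` all large blocks `K ≥ K₀(ε)` admit numbers `farK, deepK` and an
energy `E` with: the priced gap on the block `F K³ · e + κ · farK ≤ E`, the trial-state bound
`E ≤ F K³ · (e_Q + ε)`, the count `deepK · m ≤ farK` and the depth bound
`K³ ≤ deepK + 6 L K²`.  Then `κ · m ≤ F · (e_Q − e)`. [folklore] -/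
theorem pricing_of_blockEstimates {κ e eQ : ℝ} {F m L : ℕ} (hκ : 0 < κ) (hF : 0 < F)
    (hblocks : ∀ ε : ℝ, 0 < ε → ∃ K₀ : ℕ, 0 < K₀ ∧ ∀ K : ℕ, K₀ ≤ K →
      ∃ (farK deepK : ℕ) (E : ℝ), (F : ℝ) * (K : ℝ) ^ 3 * e + κ * (farK : ℝ) ≤ E ∧
        E ≤ (F : ℝ) * (K : ℝ) ^ 3 * (eQ + ε) ∧ deepK * m ≤ farK ∧ K ^ 3 ≤ deepK + 6 * L * K ^ 2) :
    κ * (m : ℝ) ≤ (F : ℝ) * (eQ - e) := by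
  by_contra hlt
  rw [not_le] at hlt
  have hFr : (0 : ℝ) < F := by exact_mod_cast hF
  set δ := κ * (m : ℝ) - (F : ℝ) * (eQ - e) with hδ
  have hδ0 : 0 < δ := by rw [hδ]; linarith
  obtain ⟨K₀, hK₀, hK⟩ := hblocks (δ / (3 * F)) (by positivity)
  -- a large `K`: beyond `K₀`, beyond `6L`, and with `6·L·κ·m ≤ (δ/3)·K`
  obtain ⟨K₁, hK₁⟩ := exists_nat_gt (18 * L * κ * m / δ)
  set K := max K₀ (max (6 * L) (K₁ + 1))
  have hKK₀ : K₀ ≤ K := le_max_left _ _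
  have hKK₁ : K₁ + 1 ≤ K := (le_max_right _ _).trans (le_max_right _ _)
  have hKpos : (0 : ℝ) < K := by exact_mod_cast lt_of_lt_of_le hK₀ hKK₀
  have hK1r : (K₁ : ℝ) + 1 ≤ K := by exact_mod_cast hKK₁
  obtain ⟨farK, deepK, E, hgapK, hE, hch, hdeep⟩ := hK K hKK₀
  -- far block points: at least `(K³ − 6·L·K²)·m`
  have hchR : ((K : ℝ) ^ 3 - 6 * L * (K : ℝ) ^ 2) * (m : ℝ) ≤ (farK : ℝ) := by
    have h1 : ((K : ℝ) ^ 3 - 6 * L * (K : ℝ) ^ 2) ≤ (deepK : ℝ) := by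
      have := (Nat.cast_le (α := ℝ)).2 hdeep; push_cast at this ⊢; linarith
    have h2 : (deepK : ℝ) * (m : ℝ) ≤ (farK : ℝ) := by exact_mod_cast hch
    nlinarith [Nat.cast_nonneg (α := ℝ) m]
  -- `6·L·κ·m·K² ≤ (δ/3)·K³`
  have hsmall : 6 * L * κ * (m : ℝ) * (K : ℝ) ^ 2 ≤ δ / 3 * (K : ℝ) ^ 3 := by
    have h1 : 18 * L * κ * (m : ℝ) / δ < K := by linarith
    rw [div_lt_iff₀ hδ0] at h1
    have hK2 : (0 : ℝ) ≤ (K : ℝ) ^ 2 := by positivity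
    nlinarith
  -- combine
  have hmono : κ * (((K : ℝ) ^ 3 - 6 * L * (K : ℝ) ^ 2) * (m : ℝ)) ≤ κ * (farK : ℝ) :=
    mul_le_mul_of_nonneg_left hchR hκ.le
  have hK3 : (0 : ℝ) < (K : ℝ) ^ 3 := by positivity
  have key : (K : ℝ) ^ 3 * (κ * (m : ℝ) - δ / 3) ≤
      (K : ℝ) ^ 3 * ((F : ℝ) * (eQ - e) + δ / 3) := by
    have hE' : E ≤ (F : ℝ) * (K : ℝ) ^ 3 * eQ + (K : ℝ) ^ 3 * (δ / 3) := by
      have : (F : ℝ) * (K : ℝ) ^ 3 * (δ / (3 * F)) = (K : ℝ) ^ 3 * (δ / 3) := by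
        field_simp
      nlinarith
    nlinarith
  have := le_of_mul_le_mul_left key hK3
  rw [hδ] at this
  linarith

/-! ## (FAR) ⇒ the periodic far-site pricing (blocks) -/

/-- **The Barlow far-site gap implies the periodic far-site pricing** (same `κ`): apply (FAR)
to the blocks `blockConfig Q K`; `(depth Q 4)`-deep block points over far motif points are far
in the block, non-deep lattice coordinates are `≤ 6 · depth · K²`, and blocks are `V_χ`-trial
states (`exists_block_energy_le_truncLJ`); the arithmetic is `pricing_of_blockEstimates`.
[folklore] -/
theorem periodicFarPricing_of_farSiteGap : (∃ κ : ℝ, 0 < κ ∧ ∀ (N : ℕ) (y : Fin N → EuclideanSpace ℝ (Fin 3)), Function.Injective y → (N : ℝ) * (⨅ Q : Literature.MathematicalPhysics.StatisticalMechanics.PeriodicConfiguration 3, Q.energyPerParticle (fun r => min 1 (max 0 (4 - 2 * r)) * Literature.MathematicalPhysics.StatisticalMechanics.lennardJones r)) + κ * (Nat.card {i : Fin N // ¬ ∃ (a c : ℝ) (s : ℤ → ℤ) (g : EuclideanSpace ℝ (Fin 3) ≃ᵃⁱ[ℝ] EuclideanSpace ℝ (Fin 3)), 93 / 100 ≤ a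 ∧ a ≤ 51 / 50 ∧ 78 / 100 * a ≤ c ∧ c ≤ 86 / 100 * a ∧ Literature.MathematicalPhysics.StatisticalMechanics.IsHaggSeq s ∧ (∀ j k : Fin N, j ≠ k → dist (y j) (y i) ≤ 3 * a → a / 2 ≤ dist (y j) (y k)) ∧ (∀ j : Fin N, dist (y j) (y i) ≤ 3 * a → ∃ z ∈ Literature.MathematicalPhysics.StatisticalMechanics.barlowStacking a c s, dist (y j) (g z) ≤ a / 50) ∧ (∀ z ∈ Literature.MathematicalPhysics.StatisticalMechanics.barlowStacking a c s, dist (g z) (y i) ≤ 3 * a → ∃ j : Fin N, dist (y j) (g z) ≤ a / 50)} : ℝ) ≤ Literature.MathematicalPhysics.StatisticalMechanics.interactionEnergy (fun r => min 1 (max 0 (4 - 2 * r)) * Literature.MathematicalPhysics.StatisticalMechanics.lennardJones r) y) → (∃ κ : ℝ, 0 < κ ∧ ∀ Q : Literature.MathematicalPhysics.StatisticalMechanics.PeriodicConfiguration 3, κ * (Nat.card {x : Q.motif // ¬ ∃ (a c : ℝ) (s : ℤ → ℤ) (g : EuclideanSpace ℝ (Fin 3) ≃ᵃⁱ[ℝ]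 EuclideanSpace ℝ (Fin 3)), 93 / 100 ≤ a ∧ a ≤ 51 / 50 ∧ 78 / 100 * a ≤ c ∧ c ≤ 86 / 100 * a ∧ Literature.MathematicalPhysics.StatisticalMechanics.IsHaggSeq s ∧ (∀ j k : Q.points, j ≠ k → dist ((Subtype.val : Q.points → EuclideanSpace ℝ (Fin 3)) j) ((Subtype.val : Q.points → EuclideanSpace ℝ (Fin 3)) ⟨x.1, Q.mem_points_of_mem_motif x.2⟩) ≤ 3 * a → a / 2 ≤ dist ((Subtype.val : Q.points → EuclideanSpace ℝ (Fin 3)) j) ((Subtype.val : Q.points → EuclideanSpace ℝ (Fin 3)) k)) ∧ (∀ j : Q.points, dist ((Subtype.val : Q.points → EuclideanSpace ℝ (Fin 3)) j) ((Subtype.val : Q.points → EuclideanSpace ℝ (Fin 3)) ⟨x.1, Q.mem_points_of_mem_motif x.2⟩) ≤ 3 * a → ∃ z ∈ Literature.MathematicalPhysics.StatisticalMechanics.barlowStacking a c s, dist ((Subtype.val : Q.points → EuclideanSpace ℝ (Fin 3)) j) (g z) ≤ a / 50) ∧ (∀ z ∈ Literature.MathematicalPhysics.StatisticalMechanics.barlowStacking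 a c s, dist (g z) ((Subtype.val : Q.points → EuclideanSpace ℝ (Fin 3)) ⟨x.1, Q.mem_points_of_mem_motif x.2⟩) ≤ 3 * a → ∃ j : Q.points, dist ((Subtype.val : Q.points → EuclideanSpace ℝ (Fin 3)) j) (g z) ≤ a / 50)} : ℝ) ≤ (Q.motif.card : ℝ) * (Q.energyPerParticle (fun r => min 1 (max 0 (4 - 2 * r)) * Literature.MathematicalPhysics.StatisticalMechanics.lennardJones r) - ⨅ Q' : Literature.MathematicalPhysics.StatisticalMechanics.PeriodicConfiguration 3, Q'.energyPerParticle (fun r => min 1 (max 0 (4 - 2 * r)) * Literature.MathematicalPhysics.StatisticalMechanics.lennardJones r))) := by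
  rintro ⟨κ, hκ, hgap⟩
  refine ⟨κ, hκ, fun Q => ?_⟩
  refine pricing_of_blockEstimates (L := depth Q 4) hκ Q.motif_nonempty.card_pos ?_
  intro ε hε
  obtain ⟨K₀, hK₀, hK⟩ := exists_block_energy_le_truncLJ Q ε hε
  refine ⟨K₀, hK₀, fun K hKK₀ => ?_⟩
  have hn : ((Fintype.card (BIdx Q K) : ℕ) : ℝ) = (Q.motif.card : ℝ) * (K : ℝ) ^ 3 := by
    exact_mod_cast card_BIdx Q K
  refine ⟨Nat.card {u : BIdx Q K // ¬ ∃ (a c : ℝ) (s : ℤ → ℤ) (g : EuclideanSpace ℝ (Fin 3) ≃ᵃⁱ[ℝ] EuclideanSpace ℝ (Fin 3)), 93 / 100 ≤ a ∧ a ≤ 51 / 50 ∧ 78 / 100 * a ≤ c ∧ c ≤ 86 / 100 * a ∧ Literature.MathematicalPhysics.StatisticalMechanics.IsHaggSeq s ∧ (∀ j k, j ≠ k → dist ((bpt Q K) j) ((bpt Q K) u) ≤ 3 * a → a / 2 ≤ dist ((bpt Q K) j) ((bpt Q K) k)) ∧ (∀ j, dist ((bpt Q K) j) ((bpt Q K)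 u) ≤ 3 * a → ∃ z ∈ Literature.MathematicalPhysics.StatisticalMechanics.barlowStacking a c s, dist ((bpt Q K) j) (g z) ≤ a / 50) ∧ (∀ z ∈ Literature.MathematicalPhysics.StatisticalMechanics.barlowStacking a c s, dist (g z) ((bpt Q K) u) ≤ 3 * a → ∃ j, dist ((bpt Q K) j) (g z) ≤ a / 50)},
    Nat.card {k : Fin 3 → Fin K // IsDeep K (depth Q 4) k},
    interactionEnergy (fun r => min 1 (max 0 (4 - 2 * r)) * lennardJones r) (blockConfig Q K),
    ?_, ?_, ?_, ?_⟩
  · have h := hgap _ (blockConfig Q K) (blockConfig_injective Q K)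
    rw [far_blockConfig_eq, hn] at h
    exact h
  · have h := hK K hKK₀
    rw [hn] at h
    exact h
  · exact card_far_block_ge Q K
  · exact card_deep_ge K (depth Q 4)

end Summit.AtomisticToContinuum.Crystallization.Theorems.PricedLinkCensusTruncatedCensusGap

end
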